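import Literature.AlgebraicGeometry.Frobenioids.QuasiTemperoidConnected
import Mathlib.CategoryTheory.Comma.Over.Basic
import Mathlib.CategoryTheory.EssentialImage
import Mathlib.Tactic.Group
import HarnessLib

/-!
# Frobenioids II, Example 1.3 (i): the induction equivalence `B^temp(Π°) ≃ B^temp(Π)_{Π/Π°}` (proof)

Mochizuki, *The geometry of Frobenioids II*, Kyushu J. Math. **62** (2008) 401–460, §1 Example 1.3
(i), author's text p. 11 [cite: MochizukiFrdII2008, Ex 1.3 (i) p.11]: "Note that there is a natural
equivalence of categories `B^temp(Π°) ⥲ B^temp(Π)_{Π/Π°}`".  The statement file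
`Literature.AlgebraicGeometry.Frobenioids.QuasiTemperoid` records this sentence as the named fact
`QuasiTemperoid.InductionEquivalence`; this proof-only companion discharges it
(`inductionEquivalence_holds`).

Proof.  The *fibre functor* `B^temp(Π)_{Π/Π°} → B^temp(Π°)` sends `X → Π/Π°` to the fibre over the
trivial coset with its `Π°`-action.  It is faithful (a `Π`-map over `Π/Π°` is determined on the fibre,
every point being a `Π`-translate of a point of the fibre), full (a `Π°`-map of fibres `φ` extends
uniquely to `x = g · x₁ ↦ g · φ(x₁)`), and essentially surjective (the fibre of the induced `Π`-set
`Π ×^{Π°} Y → Π/Π°` is `Y`; the induced set is countable because `Π/Π°` is countable for `Π`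
tempered, [SemiAnbd] Rmk 3.1.2, and its stabilisers are conjugates of stabilisers in the open
subgroup `Π°`).  A fully faithful, essentially surjective functor is an equivalence.  Proof-only: no
definitions (the fibre functor and the induced `Π`-set are built inside the proof).

History: this is seat abc-iut-L6-t8's file (p405402), re-landed verbatim by abc-iut-L1-d5 after an
accidental same-path overwrite (p405887), except that the three pointwise action lemmas it opened with
are now taken from `QuasiTemperoidConnected.lean` (`BTempConnected.ρ_one_apply`, `ρ_mul_apply`,
`hom_ρ`), which landed in between. The general induction functor along an open homomorphism is
`QuasiTemperoidInductionFunctor.lean`.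
-/

open CategoryTheory Topology
open Literature.AnabelianGeometry.SemiGraphs

namespace Literature.AlgebraicGeometry.Frobenioids

namespace QuasiTemperoid

universe u

variable {G : Type u} [Group G] [TopologicalSpace G]

variable (G) in
/-- **Example 1.3 (i)** (FrdII p. 11), PROVED: "there is a natural equivalence of categories
`B^temp(Π°) ⥲ B^temp(Π)_{Π/Π°}`" for `Π` tempered and `Π° ⊆ Π` open — the fibre functor over the
trivial coset is fully faithful and essentially surjective (induction `Y ↦ Π ×^{Π°} Y`).
[cite: MochizukiFrdII2008, Ex 1.3 (i) p.11] -/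
theorem inductionEquivalence_holds : InductionEquivalence G := by
  intro _ hG H hH
  classical
  -- notation: the base object `Q = Π/Π°` and its base point
  let Q : BTemp G := cosetObj G hG H hH
  let e : G ⧸ H := ((1 : G) : G ⧸ H)
  have hQρ : ∀ (g a : G), Q.obj.ρ g (a : G ⧸ H) = ((g * a : G) : G ⧸ H) := fun g a => by
    change g • (a : G ⧸ H) = _
    rw [MulAction.Quotient.smul_coe, smul_eq_mul]
  -- the structure map of an object over `Q`, pointwise, and its compatibilities
  have hw : ∀ {X X' : Over Q} (f : X ⟶ X') (x : X.left.obj.V),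
      (X'.hom.hom.hom (f.left.hom.hom x) : G ⧸ H) = X.hom.hom.hom x := fun {X X'} f x => by
    have h := Over.w f
    exact congrArg (fun k : X.left ⟶ Q => (k.hom.hom x : G ⧸ H)) h
  have hfib : ∀ (X : Over Q) (h : H) (x : X.left.obj.V), X.hom.hom.hom x = e →
      X.hom.hom.hom (X.left.obj.ρ (h : G) x) = e := fun X h x hx => by
    rw [BTempConnected.hom_ρ X.hom, hx]
    change Q.obj.ρ (h : G) ((1 : G) : G ⧸ H) = ((1 : G) : G ⧸ H)
    rw [hQρ, mul_one]
    change (((h : G)) : G ⧸ H) = ((1 : G) : G ⧸ H)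
    rw [QuotientGroup.eq, mul_one, inv_mem_iff]
    exact h.2
  /- ## The fibre functor `Fib : B^temp(Π)_{Π/Π°} ⥤ B^temp(Π°)` -/
  let FV : Over Q → Type u := fun X => {x : X.left.obj.V // X.hom.hom.hom x = e}
  let FA : ∀ X : Over Q, Action (Type u) H := fun X =>
    { V := FV X
      ρ :=
        { toFun := fun h => TypeCat.ofHom fun x : FV X =>
            (⟨X.left.obj.ρ (h : G) x.1, hfib X h x.1 x.2⟩ : FV X)
          map_one' := by
            apply ConcreteCategory.hom_ext
            intro x
            apply Subtype.ext
            change X.left.obj.ρ ((1 : H) : G) x.1 = x.1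
            rw [OneMemClass.coe_one, BTempConnected.ρ_one_apply]
          map_mul' := fun a b => by
            apply ConcreteCategory.hom_ext
            intro x
            apply Subtype.ext
            change X.left.obj.ρ ((a * b : H) : G) x.1 = X.left.obj.ρ (a : G) (X.left.obj.ρ (b : G) x.1)
            rw [Subgroup.coe_mul, BTempConnected.ρ_mul_apply] } }
  have hFA : ∀ (X : Over Q) (h : H) (x : FV X), ((FA X).ρ h x : FV X).1 = X.left.obj.ρ (h : G) x.1 :=
    fun _ _ _ => rfl
  let Fob : Over Q → BTemp H := fun X =>
    ⟨FA X, by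
      haveI : Countable X.left.obj.V := X.left.property.1
      refine ⟨inferInstanceAs (Countable (FV X)), fun x => ?_⟩
      have : {h : H | (FA X).ρ h x = x} = Subtype.val ⁻¹' {g : G | X.left.obj.ρ g x.1 = x.1} := by
        ext h
        simp only [Set.mem_setOf_eq, Set.mem_preimage]
        rw [Subtype.ext_iff, hFA]
      rw [this]
      exact (X.left.property.2 x.1).preimage continuous_subtype_val⟩
  let Fib : Over Q ⥤ BTemp H :=
    { obj := Fob
      map := fun {X X'} f => ObjectProperty.homMk
        { hom := TypeCat.ofHom fun x : FV X =>
            (⟨f.left.hom.hom x.1, by rw [hw f x.1]; exact x.2⟩ : FV X')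
          comm := fun h => by
            apply ConcreteCategory.hom_ext
            intro x
            apply Subtype.ext
            change f.left.hom.hom (X.left.obj.ρ (h : G) x.1) = X'.left.obj.ρ (h : G) (f.left.hom.hom x.1)
            exact BTempConnected.hom_ρ f.left (h : G) x.1 }
      map_id := fun X => by
        apply ObjectProperty.hom_ext
        apply Action.hom_ext
        apply ConcreteCategory.hom_ext
        intro x
        apply Subtype.ext
        rfl
      map_comp := fun f g => by
        apply ObjectProperty.hom_ext
        apply Action.hom_ext
        apply ConcreteCategory.hom_ext
        intro x
        apply Subtype.ext
        rfl }
  have hFib : ∀ {X X' : Over Q} (f : X ⟶ X') (x : FV X),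
      ((Fib.map f).hom.hom x : FV X').1 = f.left.hom.hom x.1 := fun _ _ => rfl
  /- ## Translating points into the fibre -/
  -- a representative of the coset of a point
  let σ : ∀ X : Over Q, X.left.obj.V → G := fun X x => (X.hom.hom.hom x : G ⧸ H).out
  have hσ : ∀ (X : Over Q) (x : X.left.obj.V), ((σ X x : G) : G ⧸ H) = X.hom.hom.hom x :=
    fun X x => Quotient.out_eq _
  -- translating a point over `gΠ°` by `g⁻¹` lands in the fibre
  have hback : ∀ (X : Over Q) (g : G) (x : X.left.obj.V), ((g : G) : G ⧸ H) = X.hom.hom.hom x →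
      X.hom.hom.hom (X.left.obj.ρ g⁻¹ x) = e := fun X g x hg => by
    rw [BTempConnected.hom_ρ X.hom, ← hg]
    change Q.obj.ρ g⁻¹ (g : G ⧸ H) = ((1 : G) : G ⧸ H)
    rw [hQρ, inv_mul_cancel]
  /- ## Faithful -/
  haveI : Fib.Faithful := ⟨fun {X X'} {f f'} hff' => by
    apply Over.OverMorphism.ext
    apply ObjectProperty.hom_ext
    apply Action.hom_ext
    apply ConcreteCategory.hom_ext
    intro x
    let x₁ : FV X := ⟨X.left.obj.ρ (σ X x)⁻¹ x, hback X _ x (hσ X x)⟩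
    have hx : x = X.left.obj.ρ (σ X x) x₁.1 := by
      change x = X.left.obj.ρ (σ X x) (X.left.obj.ρ (σ X x)⁻¹ x)
      rw [← BTempConnected.ρ_mul_apply, mul_inv_cancel, BTempConnected.ρ_one_apply]
    have h₁ : (f.left.hom.hom x₁.1 : X'.left.obj.V) = f'.left.hom.hom x₁.1 := by
      rw [← hFib f x₁, ← hFib f' x₁, hff']
    change (f.left.hom.hom x : X'.left.obj.V) = f'.left.hom.hom x
    rw [hx, BTempConnected.hom_ρ f.left, BTempConnected.hom_ρ f'.left, h₁]⟩
  /- ## Full -/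
  haveI : Fib.Full := ⟨fun {X X'} φ => by
    -- the extension `x = g · x₁ ↦ g · φ(x₁)`
    let ext : ∀ (g : G) (x : X.left.obj.V), ((g : G) : G ⧸ H) = X.hom.hom.hom x → X'.left.obj.V :=
      fun g x hg => X'.left.obj.ρ g (φ.hom.hom ⟨X.left.obj.ρ g⁻¹ x, hback X g x hg⟩ : FV X').1
    -- independence of the representative
    have hext : ∀ (g g' : G) (x : X.left.obj.V) (hg : ((g : G) : G ⧸ H) = X.hom.hom.hom x)
        (hg' : ((g' : G) : G ⧸ H) = X.hom.hom.hom x), ext g x hg = ext g' x hg' := by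
      intro g g' x hg hg'
      have hh : g⁻¹ * g' ∈ H := by rw [← QuotientGroup.eq, hg, hg']
      let h : H := ⟨g⁻¹ * g', hh⟩
      have h1 : (⟨X.left.obj.ρ g⁻¹ x, hback X g x hg⟩ : FV X) =
          (FA X).ρ h ⟨X.left.obj.ρ g'⁻¹ x, hback X g' x hg'⟩ := by
        apply Subtype.ext
        rw [hFA]
        change X.left.obj.ρ g⁻¹ x = X.left.obj.ρ (g⁻¹ * g') (X.left.obj.ρ g'⁻¹ x)
        rw [← BTempConnected.ρ_mul_apply, mul_assoc, mul_inv_cancel, mul_one]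
      change X'.left.obj.ρ g (φ.hom.hom ⟨X.left.obj.ρ g⁻¹ x, hback X g x hg⟩ : FV X').1 =
        X'.left.obj.ρ g' (φ.hom.hom ⟨X.left.obj.ρ g'⁻¹ x, hback X g' x hg'⟩ : FV X').1
      rw [h1, BTempConnected.hom_ρ φ h, hFA]
      change X'.left.obj.ρ g (X'.left.obj.ρ (g⁻¹ * g') _) = _
      rw [← BTempConnected.ρ_mul_apply, ← mul_assoc, mul_inv_cancel, one_mul]
    let F : X.left.obj.V → X'.left.obj.V := fun x => ext (σ X x) x (hσ X x)
    have hF : ∀ (g : G) (x : X.left.obj.V) (hg : ((g : G) : G ⧸ H) = X.hom.hom.hom x),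
        F x = ext g x hg := fun g x hg => hext (σ X x) g x (hσ X x) hg
    -- equivariance
    have hFρ : ∀ (g : G) (x : X.left.obj.V), F (X.left.obj.ρ g x) = X'.left.obj.ρ g (F x) := by
      intro g x
      have hg : ((g * σ X x : G) : G ⧸ H) = X.hom.hom.hom (X.left.obj.ρ g x) := by
        rw [BTempConnected.hom_ρ X.hom, ← hσ X x]
        exact (hQρ g (σ X x)).symm
      rw [hF (g * σ X x) _ hg]
      change X'.left.obj.ρ (g * σ X x) (φ.hom.hom ⟨X.left.obj.ρ (g * σ X x)⁻¹ (X.left.obj.ρ g x), _⟩ :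
          FV X').1 = X'.left.obj.ρ g (X'.left.obj.ρ (σ X x) (φ.hom.hom ⟨X.left.obj.ρ (σ X x)⁻¹ x, _⟩ :
          FV X').1)
      have h2 : (⟨X.left.obj.ρ (g * σ X x)⁻¹ (X.left.obj.ρ g x), hback X _ _ hg⟩ : FV X) =
          ⟨X.left.obj.ρ (σ X x)⁻¹ x, hback X _ x (hσ X x)⟩ := by
        apply Subtype.ext
        change X.left.obj.ρ (g * σ X x)⁻¹ (X.left.obj.ρ g x) = X.left.obj.ρ (σ X x)⁻¹ x
        rw [← BTempConnected.ρ_mul_apply, mul_inv_rev, mul_assoc, inv_mul_cancel, mul_one]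
      rw [h2, BTempConnected.ρ_mul_apply]
    -- compatibility with the structure maps
    have hFw : ∀ x : X.left.obj.V, X'.hom.hom.hom (F x) = X.hom.hom.hom x := by
      intro x
      change X'.hom.hom.hom (X'.left.obj.ρ (σ X x) (φ.hom.hom ⟨X.left.obj.ρ (σ X x)⁻¹ x, _⟩ :
        FV X').1) = X.hom.hom.hom x
      rw [BTempConnected.hom_ρ X'.hom, (φ.hom.hom ⟨X.left.obj.ρ (σ X x)⁻¹ x, hback X _ x (hσ X x)⟩ : FV X').2]
      change Q.obj.ρ (σ X x) ((1 : G) : G ⧸ H) = X.hom.hom.hom x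
      rw [hQρ, mul_one, hσ]
    let f : X ⟶ X' := Over.homMk (ObjectProperty.homMk
      { hom := TypeCat.ofHom F
        comm := fun g => by
          apply ConcreteCategory.hom_ext
          intro x
          exact hFρ g x }) (by
        apply ObjectProperty.hom_ext
        apply Action.hom_ext
        apply ConcreteCategory.hom_ext
        intro x
        exact hFw x)
    refine ⟨f, ?_⟩
    apply ObjectProperty.hom_ext
    apply Action.hom_ext
    apply ConcreteCategory.hom_ext
    intro x
    apply Subtype.ext
    rw [hFib]
    change F x.1 = (φ.hom.hom x : FV X').1
    have h1 : (((1 : G) : G) : G ⧸ H) = X.hom.hom.hom x.1 := x.2.symm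
    rw [hF 1 x.1 h1]
    change X'.left.obj.ρ 1 (φ.hom.hom ⟨X.left.obj.ρ 1⁻¹ x.1, _⟩ : FV X').1 = (φ.hom.hom x : FV X').1
    have h3 : (⟨X.left.obj.ρ 1⁻¹ x.1, hback X 1 x.1 h1⟩ : FV X) = x := by
      apply Subtype.ext
      change X.left.obj.ρ 1⁻¹ x.1 = x.1
      rw [inv_one, BTempConnected.ρ_one_apply]
    rw [BTempConnected.ρ_one_apply, h3]⟩
  /- ## Essentially surjective: induction -/
  haveI : Fib.EssSurj := ⟨fun Y => by
    haveI : Countable Y.obj.V := Y.property.1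
    haveI : Countable (G ⧸ H) := hG.countable_quotient H hH
    -- the induced `Π`-set `Π ×^{Π°} Y`
    let S : Setoid (G × Y.obj.V) :=
      { r := fun p q => ∃ h : H, q.1 = p.1 * h ∧ p.2 = Y.obj.ρ h q.2
        iseqv :=
          { refl := fun p => ⟨1, by rw [OneMemClass.coe_one, mul_one], by rw [BTempConnected.ρ_one_apply]⟩
            symm := fun {p q} ⟨h, h1, h2⟩ => ⟨h⁻¹, by
                rw [h1, InvMemClass.coe_inv, mul_assoc, mul_inv_cancel, mul_one], by
                rw [h2, ← BTempConnected.ρ_mul_apply, inv_mul_cancel, BTempConnected.ρ_one_apply]⟩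
            trans := fun {p q s} ⟨h₁, h11, h12⟩ ⟨h₂, h21, h22⟩ => ⟨h₁ * h₂, by
                rw [h21, h11, Subgroup.coe_mul, mul_assoc], by
                rw [h12, h22, ← BTempConnected.ρ_mul_apply]⟩ } }
    let IV : Type u := Quotient S
    let act : G → IV → IV := fun g => Quotient.map' (fun p : G × Y.obj.V => (g * p.1, p.2))
      fun p q ⟨h, h1, h2⟩ => ⟨h, by change g * q.1 = g * p.1 * h; rw [h1, mul_assoc], h2⟩
    have hact : ∀ (g a : G) (y : Y.obj.V), act g (Quotient.mk S (a, y)) = Quotient.mk S (g * a, y) :=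
      fun _ _ _ => rfl
    let IA : Action (Type u) G :=
      { V := IV
        ρ :=
          { toFun := fun g => TypeCat.ofHom (act g)
            map_one' := by
              apply ConcreteCategory.hom_ext
              intro q
              induction q using Quotient.inductionOn with
              | h p =>
                change act 1 (Quotient.mk S (p.1, p.2)) = Quotient.mk S (p.1, p.2)
                rw [hact, one_mul]
            map_mul' := fun a b => by
              apply ConcreteCategory.hom_ext
              intro q
              induction q using Quotient.inductionOn with
              | h p =>
                change act (a * b) (Quotient.mk S (p.1, p.2)) = act a (act b (Quotient.mk S (p.1, p.2)))
                rw [hact, hact, hact, mul_assoc] } }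
    have hIA : ∀ (g a : G) (y : Y.obj.V), IA.ρ g (Quotient.mk S (a, y)) = Quotient.mk S (g * a, y) :=
      fun _ _ _ => rfl
    have hrel : ∀ (a : G) (h : H) (y : Y.obj.V),
        Quotient.mk S (a * h, y) = Quotient.mk S (a, Y.obj.ρ h y) := fun a h y =>
      (Quotient.sound (⟨h, rfl, rfl⟩ : S.r (a, Y.obj.ρ h y) (a * h, y))).symm
    -- membership in `B^temp(Π)`
    have hIT : temperedAction G IA := by
      refine ⟨?_, fun q => ?_⟩
      · -- countable: image of `(Π/Π°) × Y`
        refine Function.Surjective.countable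
          (f := fun cy : (G ⧸ H) × Y.obj.V => (Quotient.mk S (cy.1.out, cy.2) : IV)) fun q => ?_
        induction q using Quotient.inductionOn with
        | h p =>
          have hh : p.1⁻¹ * (p.1 : G ⧸ H).out ∈ H := by
            rw [← QuotientGroup.eq]
            exact (Quotient.out_eq _).symm
          obtain ⟨k, hk⟩ : ∃ k : H, ((p.1 : G ⧸ H).out : G) = p.1 * k :=
            ⟨⟨p.1⁻¹ * (p.1 : G ⧸ H).out, hh⟩, by
              change _ = p.1 * (p.1⁻¹ * _)
              rw [← mul_assoc, mul_inv_cancel, one_mul]⟩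
          refine ⟨((p.1 : G ⧸ H), Y.obj.ρ k⁻¹ p.2), ?_⟩
          change Quotient.mk S ((p.1 : G ⧸ H).out, Y.obj.ρ k⁻¹ p.2) = Quotient.mk S (p.1, p.2)
          rw [hk, hrel, ← BTempConnected.ρ_mul_apply, mul_inv_cancel, BTempConnected.ρ_one_apply]
      · -- open stabilisers: conjugates of stabilisers in `Π°`
        induction q using Quotient.inductionOn with
        | h p =>
          have hopen : IsOpen (Subtype.val '' {h : H | Y.obj.ρ h p.2 = p.2} : Set G) :=
            hH.isOpenMap_subtype_val _ (Y.property.2 p.2)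
          have hcont : Continuous fun k : G => p.1⁻¹ * k⁻¹ * p.1 := by fun_prop
          have : {g : G | IA.ρ g (Quotient.mk S p) = Quotient.mk S p} =
              (fun k : G => p.1⁻¹ * k⁻¹ * p.1) ⁻¹' (Subtype.val '' {h : H | Y.obj.ρ h p.2 = p.2}) := by
            ext g
            simp only [Set.mem_setOf_eq, Set.mem_preimage, Set.mem_image]
            constructor
            · intro hg
              change Quotient.mk S (g * p.1, p.2) = Quotient.mk S (p.1, p.2) at hg
              obtain ⟨h, h1, h2⟩ := Quotient.exact hg
              refine ⟨h, h2.symm, ?_⟩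
              have h1' : p.1 = g * p.1 * h := h1
              rw [eq_inv_mul_of_mul_eq h1'.symm]
              group
            · rintro ⟨h, h2, h1⟩
              change Quotient.mk S (g * p.1, p.2) = Quotient.mk S (p.1, p.2)
              apply Quotient.sound
              refine ⟨h, ?_, ?_⟩
              · change p.1 = g * p.1 * (h : G)
                rw [h1]
                group
              · exact (h2 : Y.obj.ρ h p.2 = p.2).symm
          rw [this]
          exact hopen.preimage hcont
    let IT : BTemp G := ⟨IA, hIT⟩
    -- the structure map `Π ×^{Π°} Y → Π/Π°`
    let π : IV → G ⧸ H := fun q => Quotient.liftOn' q (fun p => (p.1 : G ⧸ H))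
      fun p p' ⟨h, h1, _⟩ => by
        rw [QuotientGroup.eq, h1, ← mul_assoc, inv_mul_cancel, one_mul]
        exact h.2
    have hπ : ∀ (a : G) (y : Y.obj.V), π (Quotient.mk S (a, y)) = (a : G ⧸ H) := fun _ _ => rfl
    let X : Over Q := Over.mk (Y := IT) (ObjectProperty.homMk
      { hom := TypeCat.ofHom π
        comm := fun g => by
          apply ConcreteCategory.hom_ext
          intro q
          induction q using Quotient.inductionOn with
          | h p =>
            change π (IA.ρ g (Quotient.mk S (p.1, p.2))) = Q.obj.ρ g (π (Quotient.mk S (p.1, p.2)))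
            rw [hIA, hπ, hπ, hQρ] })
    have hXhom : ∀ (a : G) (y : Y.obj.V), (X.hom.hom.hom (Quotient.mk S (a, y)) : G ⧸ H) = (a : G ⧸ H) :=
      fun _ _ => rfl
    -- the comparison `Y → Fib (Π ×^{Π°} Y)`, `y ↦ [1, y]`
    let ι : Y ⟶ Fib.obj X := ObjectProperty.homMk
      { hom := TypeCat.ofHom fun y => (⟨Quotient.mk S (1, y), by
          rw [hXhom]⟩ : FV X)
        comm := fun h => by
          apply ConcreteCategory.hom_ext
          intro y
          apply Subtype.ext
          change Quotient.mk S (1, Y.obj.ρ h y) = ((FA X).ρ h ⟨Quotient.mk S (1, y), _⟩ : FV X).1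
          rw [hFA]
          change Quotient.mk S (1, Y.obj.ρ h y) = IA.ρ (h : G) (Quotient.mk S (1, y))
          rw [hIA, mul_one, ← hrel, one_mul] }
    have hι : ∀ y : Y.obj.V, ((ι.hom.hom y : FV X).1 : IV) = Quotient.mk S (1, y) := fun _ => rfl
    have hbij : Function.Bijective (fun y : Y.obj.V => (ι.hom.hom y : FV X)) := by
      constructor
      · intro y y' hyy'
        have h := congrArg (fun z : FV X => (z.1 : IV)) hyy'
        change ((ι.hom.hom y : FV X).1 : IV) = (ι.hom.hom y' : FV X).1 at h
        rw [hι, hι] at h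
        obtain ⟨h, h1, h2⟩ := Quotient.exact h
        have hh1 : h = 1 := by
          apply Subtype.ext
          have : (1 : G) = 1 * (h : G) := h1
          rw [one_mul] at this
          exact this.symm
        have h2' : y = Y.obj.ρ h y' := h2
        rw [h2', hh1, BTempConnected.ρ_one_apply]
      · rintro ⟨q, hq⟩
        induction q using Quotient.inductionOn with
        | h p =>
          have hp : p.1 ∈ H := by
            have hq' : ((p.1 : G) : G ⧸ H) = ((1 : G) : G ⧸ H) := hq
            rw [QuotientGroup.eq, mul_one, inv_mem_iff] at hq'
            exact hq'
          refine ⟨Y.obj.ρ (⟨p.1, hp⟩ : H) p.2, Subtype.ext ?_⟩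
          change ((ι.hom.hom _ : FV X).1 : IV) = Quotient.mk S p
          rw [hι, ← hrel, one_mul]
    haveI : IsIso ι.hom.hom := (isIso_iff_bijective _).mpr hbij
    haveI : IsIso ι.hom := inferInstance
    haveI : IsIso ι := (ObjectProperty.isIso_hom_iff _).mp inferInstance
    exact ⟨X, ⟨(asIso ι).symm⟩⟩⟩
  haveI : Fib.IsEquivalence := {}
  exact ⟨Fib.asEquivalence.symm⟩

variable (G) in
/-- `InductionEquivalence` — `_holds` alias of `inductionEquivalence_holds` above under the fact's exact name (appended
2026-08-28, D-0026 bookkeeping: the proof term is the existing theorem of this file; no statement,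
definition or attribute is edited; no new named fact; the ledger's debt table listed the fact
unproved). [cite: MochizukiFrdII2008, Ex 1.3 (i) p.11] -/
theorem _root_.Literature.AlgebraicGeometry.Frobenioids.QuasiTemperoid.InductionEquivalence_holds :
    InductionEquivalence G :=
  _root_.Literature.AlgebraicGeometry.Frobenioids.QuasiTemperoid.inductionEquivalence_holds (G := G)

end QuasiTemperoid

end Literature.AlgebraicGeometry.Frobenioids
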